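import Summits.AtomisticToContinuum.Crystallization.Theorems.LayeredLawsSelectHcp.Negative.DiracLaws

/-!
# Route `PalmUnimodularRigidity`, crux `LayeredLawsSelectHcp` (stmt-AtomisticToContinuum-9226):
# definitions of line `mtp-prestress-split-ergodic-frame` (the rigidity half)

The checked skeleton `Cruxes/LayeredLawsSelectHcp/Lines/mtp_prestress_split_ergodic_frame.lean` states its
registered stubs over a small vocabulary of its own. By D-0016 the objects a route posits live in a reviewed
`Theorems/…Defs.lean` so that the stub proofs (separate `Theorems/` files, `--supports` the crux item) and the
final sorry-free skeleton can IMPORT them; this file is that vocabulary, verbatim from the skeleton: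

* `hcpQ`, `hcpE` — the hcp index form and the energy per particle of relaxed hcp as a TOTAL function of
  `(a, h)` (the landed series of `ExcessDecayLiouvilleCoarseGrains.hcpEnergySeries_of_eq`);
* `hcpSite`, `ljSqDeriv`, `hcpSiteStress` — hcp sites indexed by `ℤ³`, the squared-length derivative
  `W′(s) = ½(s⁻⁴ − s⁻⁷)` of `W(s) = V_LJ(√s)`, and the squared-length site stress tensor at the root;
* `hcpStarIdx`, `refStar`, `rootStar`, `starDefect` — the twelve first-shell labels, the relaxed reference
  star, the root star of a configuration measure, and the congruence defect (an `⨅` over linear isometries);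
* `HcpCharted`, `HcpLayered` — bond-isomorphism with the ideal hcp stacking, and the class of laws a.s.
  carried by everywhere-good hcp-charted configurations (`GoodShell` is `Negative.DiracLaws.GoodShell`).

All definitions carry parameters (route-internal bookkeeping, not literature facts); everything is
`[folklore]`; nothing here closes an item.
-/

noncomputable section

namespace Summit.AtomisticToContinuum.Crystallization.Theorems.PalmUnimodularRigidity.LayeredLawsSelectHcp

open MeasureTheory Set
open Literature.MathematicalPhysics.StatisticalMechanics Literature.Geometry.DiscreteGeometry
open Summit.AtomisticToContinuum.Crystallization.Theorems.LayeredLawsSelectHcp.Negative.DiracLaws (GoodShell)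

/-- Euclidean `3`-space. [folklore] -/
local notation "E3" => EuclideanSpace ℝ (Fin 3)

/-- The hcp index form `Q(k,i,j) = i² + ij + j² + [k odd](i + j + 1/3)`: the squared norm of the hcp
site `(k,i,j)` is `a² Q + k² h²` (`hcp_norm_sq_eq`; the letters of `alternatingHagg` are `0/1`).
Same `Q` as the landed `ExcessDecayLiouvilleCoarseGrains.hcpEnergySeries_of_eq`. [folklore] -/
def hcpQ (v : ℤ × ℤ × ℤ) : ℝ :=
  (v.2.1 : ℝ) ^ 2 + (v.2.1 : ℝ) * v.2.2 + (v.2.2 : ℝ) ^ 2 +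
    (if Even v.1 then 0 else ((v.2.1 : ℝ) + v.2.2 + 1 / 3))

/-- **The energy per particle of relaxed hcp as a TOTAL function of `(a, h)`**:
`hcpE a h = ½ ∑_{v ∈ ℤ³, v ≠ 0} V_LJ(√(a² Q v + k² h²))` — equal to
`(hcpPeriodicConfiguration ha hh).energyPerParticle lennardJones` for `a, h ≠ 0` (by the landed series
theorem `hcpEnergySeries_of_eq`). [cite: BlancLewin2015, §2.1 (23)] -/
def hcpE (a h : ℝ) : ℝ :=
  (1 / 2) * ∑' v : ℤ × ℤ × ℤ,
    if v = 0 then (0 : ℝ) else lennardJones (Real.sqrt (a ^ 2 * hcpQ v + (v.1 : ℝ) ^ 2 * h ^ 2))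

/-- The hcp site with indices `v = (k, i, j)` (root `= hcpSite a h 0 = 0`). [folklore] -/
def hcpSite (a h : ℝ) (v : ℤ × ℤ × ℤ) : E3 := barlowPos a h alternatingHagg v.1 v.2.1 v.2.2

/-- `W′(s) = ½ (s⁻⁴ − s⁻⁷)` for the squared-length well `W(s) = V_LJ(√s) = s⁻⁶/12 − s⁻³/6`
(negative for `s < 1`: compressed first-shell STRUTS; positive beyond: CABLES). [folklore] -/
def ljSqDeriv (s : ℝ) : ℝ := (1 / 2) * ((s⁻¹) ^ 4 - (s⁻¹) ^ 7)

/-- **The squared-length site stress tensor of hcp at the root**: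
`S_lm(a,h) = ∑_{v ≠ 0} W′(‖y_v‖²) (y_v)_l (y_v)_m`, `y_v = hcpSite a h v` (the static virial stress
per site; absolutely convergent, terms `O(‖y‖⁻⁶)`). [folklore] -/
def hcpSiteStress (a h : ℝ) (l m : Fin 3) : ℝ :=
  ∑' v : ℤ × ℤ × ℤ, if v = 0 then (0 : ℝ) else
    ljSqDeriv (‖hcpSite a h v‖ ^ 2) * (hcpSite a h v l * hcpSite a h v m)

/-- The twelve first-shell labels of the hcp root (an `A`-site): six in its layer (`i² + ij + j² = 1`)
and three in each adjacent layer (`Q = 1/3`). [folklore] -/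
def hcpStarIdx : Finset (ℤ × ℤ × ℤ) :=
  {(0, 1, 0), (0, -1, 0), (0, 0, 1), (0, 0, -1), (0, 1, -1), (0, -1, 1),
   (1, 0, 0), (1, -1, 0), (1, 0, -1), (-1, 0, 0), (-1, -1, 0), (-1, 0, -1)}

/-- **The relaxed reference star**: the twelve strut vectors of `hcp(a, h)` at the root (in-layer length
`a`, out-of-layer length `√(a²/3 + h²)`). [folklore] -/
def refStar (a h : ℝ) : Finset E3 := hcpStarIdx.image (hcpSite a h)

/-- The root star of a configuration measure: its atoms `y` with `0 < ‖y‖ ≤ 11/10`. [folklore] -/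
def rootStar (μ : Measure E3) : Set E3 := {y : E3 | μ {y} ≠ 0 ∧ 0 < ‖y‖ ∧ ‖y‖ ≤ 11 / 10}

/-- **The congruence defect of the root star** against the relaxed reference star:
`starDefect a h μ = inf_{A ∈ O(3)} ∑_{v ∈ hcpStarIdx} dist(A (hcpSite a h v), rootStar μ)²` — the discrete
Friesecke–James–Müller quantity at the root; chart-free, rotation-free, `≥ 0`. [folklore] -/
def starDefect (a h : ℝ) (μ : Measure E3) : ℝ :=
  ⨅ A : E3 ≃ₗᵢ[ℝ] E3, ∑ v ∈ hcpStarIdx, (Metric.infDist (A (hcpSite a h v)) (rootStar μ)) ^ 2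

/-- **hcp-charted set**: `S` is bond-isomorphic to the ideal hcp stacking — the crux's `BarlowLike` clause
with the Hägg word FIXED to the alternating one (`hcpStacking 1 √(2/3) = barlowStacking 1 √(2/3)
alternatingHagg` by `rfl`). [folklore] -/
def HcpCharted (S : Set E3) : Prop :=
  ∃ Φ : E3 → E3, Set.BijOn Φ (hcpStacking 1 (Real.sqrt (2 / 3))) S ∧
    ∀ p ∈ hcpStacking 1 (Real.sqrt (2 / 3)), ∀ q ∈ hcpStacking 1 (Real.sqrt (2 / 3)),
      (dist p q = 1 ↔ (0 < dist (Φ p) (Φ q) ∧ dist (Φ p) (Φ q) ≤ 28 / 25))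

/-- **hcp-layered law**: a.s. `count|S` with every point of `S` `(1/100)`-good (`GoodShell`, the "1 %
tube") and `S` hcp-charted. [folklore] -/
def HcpLayered (P : Measure (Measure E3)) : Prop :=
  ∀ᵐ μ ∂P, ∃ S : Set E3, μ = (Measure.count : Measure E3).restrict S ∧
    (∀ x ∈ S, GoodShell S x) ∧ HcpCharted S

/-! ## Elementary read-backs -/

/-- The reference star has the root's twelve strut labels. [folklore] -/
theorem card_hcpStarIdx : hcpStarIdx.card = 12 := by decide

/-- Anchor (registered sub-goal of stmt-AtomisticToContinuum-9226; the Defs module must prove one registered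
statement by name): the congruence defect is non-negative. [folklore] -/
theorem starDefect_nonneg : ∀ (a h : ℝ) (μ : Measure E3), 0 ≤ starDefect a h μ :=
  fun _ _ _ => Real.iInf_nonneg fun _ => Finset.sum_nonneg fun _ _ => sq_nonneg _

/-- `hcpStacking 1 √(2/3)` is LITERALLY `barlowStacking 1 √(2/3) alternatingHagg`, so `HcpCharted S` is the
crux's `BarlowLike S` with the word fixed. [folklore] -/
theorem hcpCharted_iff (S : Set E3) :
    HcpCharted S ↔ ∃ Φ : E3 → E3,
      Set.BijOn Φ (barlowStacking 1 (Real.sqrt (2 / 3)) alternatingHagg) S ∧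
      ∀ p ∈ barlowStacking 1 (Real.sqrt (2 / 3)) alternatingHagg,
        ∀ q ∈ barlowStacking 1 (Real.sqrt (2 / 3)) alternatingHagg,
          (dist p q = 1 ↔ (0 < dist (Φ p) (Φ q) ∧ dist (Φ p) (Φ q) ≤ 28 / 25)) :=
  Iff.rfl

end Summit.AtomisticToContinuum.Crystallization.Theorems.PalmUnimodularRigidity.LayeredLawsSelectHcp

end
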